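import Summits.QuantumFields.BalabanUV.Beta.GAN24.VertexSlotZeroMode
import Summits.QuantumFields.BalabanUV.Beta.GAN24.RespKernelColumnCharge
import Summits.QuantumFields.BalabanUV.Beta.GAN24.WWordMixedBondZero

/-!
# `BalabanUV.Beta.GAN24.BiVertexSlotZeroMode` — binder row G-an2-4 ∕ (CONV-C), row (C) at the levels `j ≥ 1`, CONTACT side; Part 29 of
# `GAN24/FourFaceGaugeSectors`: **THE SLOT ZERO MODES OF THE BI-VERTEX** — summing ONE background slot of `vertex2OfK G_j Lc S₂ μ y ν y′` over the whole step lattice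
# (every `j`, in-block root, ANY local bi-stencil family `S₂`, e.g. `S₂ = T2RecAt … j` inside `WrecAt j`):
# INNER slot `Σ_{u′} vertex2OfK G_j Lc S₂ μ y ν u′ = cH_j·vertexOfK G_j Lc (l t ↦ Σ'_s 𝟙[s_ν % Lc = Lc−1]·S₂ l t ν s) μ y` (the second table slot lands on the EXIT FACE of its own
# direction, the first stays read through the `(μ, y)`-column), OUTER slot `Σ_{u′} vertex2OfK G_j Lc S₂ ν u′ μ y = cH_j·Σ'_t 𝟙[t_ν % Lc = Lc−1]·vertexOfK G_j Lc (S₂ ν t) μ y` (the first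
# table slot lands on its exit face, the second stays read through the `(μ, y)`-column) — entrywise, and under the face-weighted pair sum of the legs

NOT IN PRINT; OUR BOOKKEEPING (G-an2-4 crux team (2), leaf prover `b2b-balaban-gan24-formalise-leaf-02`, gen 67).  WHY.  Part 26 (`QuarticMemberZeroMode`) writes road-P2's
`zmode Lc (T2RecAt … (j+1))` as `Σ_{r∈cell} Σ'_{u′} c·FF[Y_j(κr; κ′u′)]`, `Y_j(b;b′) = dM_b G_j dM_{b′} + dM_{b′} G_j dM_b − WrecAt j b b′`; Part 28 removes the slot `u′` from the two
contact words; the W-word `WrecAt j = W2SymOfK G_j Lc (SpureRecAt j) (M1At j) (T2RecAt j) (M2Of mixFF j)` splits (`W2OfK_apply`) into the bi-vertex over `S₂ = T2RecAt j` (both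
orientations, weight `½` each), the two mixed bi-vertices and the two second-response words.  leaf-04's `WWordMixedBondZero` ∕ `WWordRespSummable` carry the mixed and response
words (typed at `S₂ = 0` — the dressed SOURCE has no bi-vertex); THIS FILE carries the bi-vertex, i.e. the slot half of the LINEAR TRANSPORT of the level-`j` table through the
step — the entrance of the four-face (contact) side (`TableDressingZeroMode`: the transported table's zero mode reads the table with all four bonds on exit faces).  Mechanism:
Part 27's column rule (`VertexSlotZeroMode.hasSum_slot_vertexOfK'`) one superposition deeper — for the inner slot through the Fubini of `summable_slot_table` per outer direction,
for the outer slot VERBATIM (the outer column is the summed one, the inner vertices are a local stencil family by an2's `biLoc_vertexOfK_slice`); the pair-sum exchange by the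
centre-tied majorant (an2's `biLoc_wsum_self_far`, leaf-04's `summable_prod_of_centreTied`) resp. a moving-centre majorant.

WHAT (`G_j = coDressKBmAt ρ Lc (KInvStep Lc j)`, `cH_j = (stepScale_j·Lc^{d+1})⁻¹`; [folklore] Fubini BY NAME; 0 `def`, 0 cited facts, 0 `def … : Prop`, 0 sorry):
* §1 generic kernel `K` (`Decays K C m`), `LocStencil₂ S₂ C₂ m`: `locStencil_slot₂` (a bi-stencil slice re-centred at its second slot is a local stencil family, rate `m/2`),
  **`biLoc_vertex2OfK_far`** (the bi-vertex at a fixed first bond is bi-localised THERE with a constant decaying in the bond separation — centre-tied), `summable_prod_of_movingCentre`.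
* §2 **`hasSum_slot_vertex2OfK_inner`**, **`hasSum_slot_vertex2OfK_outer`** (entrywise slot zero modes, displayed above).
* §3 **`hasSum_slot_twoFace_vertex2OfK_inner`**, **`hasSum_slot_twoFace_vertex2OfK_outer`** (the same under `Σ'_{(x,z)} ρ₁(x)ρ₂(z)·(…) x z a b`, `|ρ| ≤ 1`).
HONEST FRAMING (cell contract, verbatim): «discharging `BetaPertH` makes Bałaban's UV stability UNCONDITIONAL — a real constructive-QFT result; it is NOT the continuum limit and
NOT the Clay problem.»  HONEST DEPENDENCY (verbatim): «continuum YM on T⁴ ⇐ BetaPertH ∧ nine spine estimates (0/9 proved); BetaPertH ⇐ (D1) ∧ (D4) ∧ CAP+tail; G-an2-4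
gates asym, D1 and NE2/3/4.»  Asserts NO value of any resolvent column beyond road-P2's two column charges (through Part 27); NO table is valued; NOTHING of (C) at j ≥ 1 ∕ `hX` ∕
(C)sym ∕ (Q-L) ∕ (FL) ∕ «T2Shape» ∕ «T2Drift» ∕ (hW, hWall) discharged; NEVER «G-an2-4 closed» as (CONV-C); NOT D1, NOT `BetaPertH`, NOT continuum, NOT Clay.  2026-08-23; no existing
file touched.
-/

noncomputable section

open Finset
open scoped BigOperators
open Literature.MathematicalPhysics.QuantumFieldTheory
open Literature.MathematicalPhysics.QuantumFieldTheory.Balaban1983to89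
open Literature.MathematicalPhysics.QuantumFieldTheory.Balaban1983to89.Beta
open B12Sec2to5 (l1 l1_nonneg)
open ExpKernelCalculus (Site MKer BiLoc Decays Zl Zl_nonneg l1_sub_triangle l1_sub_symm summable_exp_shift' tsum_exp_shift')
open OneStepResolventKernel (Fib LocStencil wsum bound_mono biLoc_mono decays_mono)
open AffineAveraging (box toSite)
open OneStepKernelFamily (KInvStep colH vertexOfK abs_colH_le)
open SecondOrderResponse (vertex2OfK biLoc_vertexOfK_slice biLoc_wsum_self_far)
open BalabanCompositeJets (LocStencil₂)
open Summit.QuantumFields.BalabanUV.Beta.TameKernelCalculus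
open Summit.QuantumFields.BalabanUV.Beta.AxialDressingRooted (coDressKBmAt decays_coDressKBmAt_KInvStep)
open Summit.QuantumFields.BalabanUV.Beta.BorderedHessian (stepScale)
open Summit.QuantumFields.BalabanUV.Beta.GAN24.KernelLegCharges (summable_exp_coarse)
open Summit.QuantumFields.BalabanUV.Beta.GAN24.VertexSlotZeroMode (hasSum_slot_vertexOfK' summable_slot_table)
open Summit.QuantumFields.BalabanUV.Beta.GAN24.RespKernelColumnCharge (summable_prod_of_centreTied)
open Summit.QuantumFields.BalabanUV.Beta.GAN24.WWordMixedBondZero (biLoc_twoFace_weight)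

namespace Summit.QuantumFields.BalabanUV.Beta.GAN24.BiVertexSlotZeroMode

variable {d : ℕ}

/-! ## §1 Generic kernel: the re-centred slice, the centre-tied bi-vertex, a moving-centre majorant -/

section Generic

variable {N : ℕ} {K : MKer (d + 1) (Fib d)} {C m : ℝ}
  {S₂ : Fin (d + 1) → Site (d + 1) → Fin (d + 1) → Site (d + 1) → MKer (d + 1) (Fib d)} {C₂ : ℝ}

/-- [folklore] **A BI-STENCIL SLICE IS A LOCAL STENCIL FAMILY IN ITS SECOND SLOT**: for `LocStencil₂ S₂ C₂ m` (`m ≥ 0`) and a fixed first slot `(l, t)`, the family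
`κ′ s ↦ S₂ l t κ′ s` is bi-localised at `(s, s)` with the SAME constant at half the rate (re-centring both legs from `t` to `s` costs the factor `e^{−m|s − t|}` of the constant). -/
theorem locStencil_slot₂ (hS₂ : LocStencil₂ S₂ C₂ m) (hm : 0 ≤ m) (l : Fin (d + 1)) (t : Site (d + 1)) :
    LocStencil (fun κ' s => S₂ l t κ' s) C₂ (m / 2) := by
  intro κ' s x z a b
  have hC₂ := hS₂.nonneg
  refine (hS₂ l t κ' s x z a b).trans ?_
  rw [mul_assoc, ← Real.exp_add]
  refine mul_le_mul_of_nonneg_left (Real.exp_le_exp.2 ?_) hC₂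
  have t1 : l1 (x - s) ≤ l1 (x - t) + l1 (t - s) := l1_sub_triangle x t s
  have t2 : l1 (z - s) ≤ l1 (z - t) + l1 (t - s) := l1_sub_triangle z t s
  have e : l1 (t - s) = l1 (s - t) := l1_sub_symm t s
  rw [e] at t1 t2
  nlinarith [mul_nonneg hm (l1_nonneg (x - t)), mul_nonneg hm (l1_nonneg (z - t)), mul_nonneg hm (l1_nonneg (s - t)),
    mul_nonneg hm (show 0 ≤ l1 (x - t) + l1 (s - t) - l1 (x - s) by linarith),
    mul_nonneg hm (show 0 ≤ l1 (z - t) + l1 (s - t) - l1 (z - s) by linarith)]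

/-- NOT IN PRINT; OUR BOOKKEEPING.  **THE BI-VERTEX AT A FIXED FIRST BOND IS CENTRE-TIED**: for `Decays K C m`, `LocStencil₂ S₂ C₂ m` (`m > 0`),
`BiLoc (vertex2OfK K N S₂ μ y ν y′) (N•y) (N•y) (Cfar·e^{−(m/8)|N•y − N•y′|}) (m/8)` — the inner vertices `vertexOfK K N (S₂ κ u) ν y′` are self-localised at `u` with constants
decaying from `N•y′` (an2's `biLoc_vertexOfK_slice`), the outer `ℋ`-column weights decay from `N•y`, and an2's `biLoc_wsum_self_far` ties the two.  (The two-centre form at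
`(N•y, N•y′)` is an2's `vertexFamily₂_vertex2OfK`; the single-centre form WITHOUT separation decay is d1's `PeriodicArrayWrapNamed.biLoc_vertex2OfK_colH`.) -/
theorem biLoc_vertex2OfK_far (hK : Decays K C m) (hC : 0 ≤ C) (hS₂ : LocStencil₂ S₂ C₂ m) (hm : 0 < m)
    (μ : Fin (d + 1)) (y : Site (d + 1)) (ν : Fin (d + 1)) (y' : Site (d + 1)) :
    BiLoc (vertex2OfK K N S₂ μ y ν y') ((N : ℤ) • y) ((N : ℤ) • y)
      (((d + 1 : ℕ) * (C * ((d + 1 : ℕ) * (C * C₂ * Zl (d + 1) (m / 2))) * Zl (d + 1) (m / 8))) * Real.exp (-(m / 8) * l1 ((N : ℤ) • y - (N : ℤ) • y')))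
      (m / 8) := by
  have hC₂ := hS₂.nonneg
  have hZ2 := Zl_nonneg (D := d + 1) (half_pos hm)
  have hK₁ : 0 ≤ (d + 1 : ℕ) * (C * C₂ * Zl (d + 1) (m / 2)) := by positivity
  have hin : ∀ (κ : Fin (d + 1)) (u : Site (d + 1)), BiLoc (vertexOfK K N (S₂ κ u) ν y') u u
      ((d + 1 : ℕ) * (C * C₂ * Zl (d + 1) (m / 2)) * Real.exp (-(m / 2) * l1 (u - (N : ℤ) • y'))) (m / 2) := by
    intro κ u
    have h := biLoc_vertexOfK_slice (N := N) hK hC hS₂ hm κ u ν y'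
    rw [← mul_assoc] at h
    exact biLoc_mono h (by positivity) (by linarith)
  have hw : ∀ (κ : Fin (d + 1)) (u : Site (d + 1)), |colH K N μ y κ u| ≤ C * Real.exp (-(m / 2) * l1 (u - (N : ℤ) • y)) :=
    fun κ u => bound_mono (abs_colH_le (N := N) hK μ y κ u) hC le_rfl (by linarith) (l1_nonneg _)
  have hterm : ∀ κ : Fin (d + 1), BiLoc (wsum (colH K N μ y κ) (fun u => vertexOfK K N (S₂ κ u) ν y')) ((N : ℤ) • y) ((N : ℤ) • y)
      (C * ((d + 1 : ℕ) * (C * C₂ * Zl (d + 1) (m / 2))) * Zl (d + 1) (m / 2 / 4) * Real.exp (-(m / 2 / 4) * l1 ((N : ℤ) • y - (N : ℤ) • y'))) (m / 2 / 4) :=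
    fun κ => biLoc_wsum_self_far (hw κ) (hin κ) (half_pos hm) hC hK₁
  have hsum := OneStepResolventKernel.biLoc_finset_sum (Finset.univ : Finset (Fin (d + 1))) (fun κ _ => hterm κ)
  simp only [Finset.sum_const, Finset.card_univ, Fintype.card_fin, nsmul_eq_mul] at hsum
  rw [show m / 2 / 4 = m / 8 by ring] at hsum
  intro x z a b
  exact (hsum x z a b).trans (le_of_eq (by ring))

set_option maxHeartbeats 400000 in
/-- [folklore] **A MOVING-CENTRE FAMILY WITH DECAYING CONSTANTS HAS AN ABSOLUTELY SUMMABLE `(u′, (x, z))` FAMILY** (`1 ≤ N`): if every `V u′` is bi-localised at its own coarse point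
`(N•u′, N•u′)` (rate `δ > 0`) with a constant `Cv·e^{−δ|N•u′ − c|₁}` decaying from a fixed `c`, then `(u′, (x, z)) ↦ V u′ x z f g` is summable (fibre sums `Cv·e^{−δ|N•u′ − c|}·Zl(δ)²`,
summable along the coarse lattice by leaf-06's `summable_exp_coarse`). -/
theorem summable_prod_of_movingCentre [NeZero N] {V : Site (d + 1) → MKer (d + 1) (Fib d)} {Cv δv : ℝ} {c : Site (d + 1)} (hδv : 0 < δv)
    (hVb : ∀ u', BiLoc (V u') ((N : ℤ) • u') ((N : ℤ) • u') (Cv * Real.exp (-δv * l1 ((N : ℤ) • u' - c))) δv) (f g : Fib d) :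
    Summable fun q : Site (d + 1) × (Site (d + 1) × Site (d + 1)) => V q.1 q.2.1 q.2.2 f g := by
  have hN : 1 ≤ N := Nat.one_le_iff_ne_zero.2 (NeZero.ne N)
  have hCv : 0 ≤ Cv := (mul_nonneg_iff_of_pos_right (Real.exp_pos _)).1 ((hVb 0).nonneg f)
  have hGle : ∀ q : Site (d + 1) × (Site (d + 1) × Site (d + 1)), |V q.1 q.2.1 q.2.2 f g| ≤ Cv * Real.exp (-δv * l1 ((N : ℤ) • q.1 - c)) *
      (Real.exp (-δv * l1 (q.2.1 - (N : ℤ) • q.1)) * Real.exp (-δv * l1 (q.2.2 - (N : ℤ) • q.1))) := by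
    intro q
    have h := hVb q.1 q.2.1 q.2.2 f g
    rw [mul_add, Real.exp_add] at h
    exact h
  have hM0 : ∀ q : Site (d + 1) × (Site (d + 1) × Site (d + 1)), 0 ≤ Cv * Real.exp (-δv * l1 ((N : ℤ) • q.1 - c)) *
      (Real.exp (-δv * l1 (q.2.1 - (N : ℤ) • q.1)) * Real.exp (-δv * l1 (q.2.2 - (N : ℤ) • q.1))) := fun q => by positivity
  have hfib : ∀ u' : Site (d + 1), Summable fun xz : Site (d + 1) × Site (d + 1) =>
      Cv * Real.exp (-δv * l1 ((N : ℤ) • u' - c)) * (Real.exp (-δv * l1 (xz.1 - (N : ℤ) • u')) * Real.exp (-δv * l1 (xz.2 - (N : ℤ) • u'))) :=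
    fun u' => ((summable_exp_shift' hδv ((N : ℤ) • u')).mul_of_nonneg (summable_exp_shift' hδv ((N : ℤ) • u'))
      (fun _ => (Real.exp_pos _).le) (fun _ => (Real.exp_pos _).le)).mul_left _
  have hfib_eq : ∀ u' : Site (d + 1), (∑' xz : Site (d + 1) × Site (d + 1),
      Cv * Real.exp (-δv * l1 ((N : ℤ) • u' - c)) * (Real.exp (-δv * l1 (xz.1 - (N : ℤ) • u')) * Real.exp (-δv * l1 (xz.2 - (N : ℤ) • u'))))
      = Cv * Real.exp (-δv * l1 ((N : ℤ) • u' - c)) * (Zl (d + 1) δv * Zl (d + 1) δv) := by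
    intro u'
    rw [tsum_mul_left, ← (summable_exp_shift' hδv _).tsum_mul_tsum (summable_exp_shift' hδv _)
      ((summable_exp_shift' hδv _).mul_of_nonneg (summable_exp_shift' hδv _) (fun _ => (Real.exp_pos _).le) (fun _ => (Real.exp_pos _).le)),
      tsum_exp_shift']
  have hmaj : Summable fun q : Site (d + 1) × (Site (d + 1) × Site (d + 1)) => Cv * Real.exp (-δv * l1 ((N : ℤ) • q.1 - c)) *
      (Real.exp (-δv * l1 (q.2.1 - (N : ℤ) • q.1)) * Real.exp (-δv * l1 (q.2.2 - (N : ℤ) • q.1))) := by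
    refine (summable_prod_of_nonneg hM0).2 ⟨hfib, ?_⟩
    simp only [hfib_eq]
    exact ((summable_exp_coarse (d := d) hN hδv c).mul_left Cv).mul_right _
  exact Summable.of_norm_bounded hmaj (fun q => by rw [Real.norm_eq_abs]; exact hGle q)

end Generic

/-! ## §2 The wall's step propagator: the two slot zero modes of the bi-vertex, entrywise -/

section Wall

variable {Lc : ℕ} [NeZero Lc] {r : Fin (d + 1) → ℕ}
  {S₂ : Fin (d + 1) → Site (d + 1) → Fin (d + 1) → Site (d + 1) → MKer (d + 1) (Fib d)} {C₂ δ₂ : ℝ}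

/-- NOT IN PRINT; OUR BOOKKEEPING.  **THE INNER SLOT ZERO MODE OF THE BI-VERTEX** (every `j`, in-block root, ANY `LocStencil₂ S₂` at a positive rate, entrywise):
`Σ_{u′} (vertex2OfK G_j Lc S₂ μ y ν u′) x z a b = cH_j·(vertexOfK G_j Lc (l t ↦ Σ'_s 𝟙[s_ν % Lc = Lc−1]·S₂ l t ν s) μ y) x z a b` — per outer direction `l`, Fubini over (outer table
slot `t`, inner bond `u′`) by Part 27's `summable_slot_table` (column decay from `Lc•y`, inner vertices bounded with decay in `|t − Lc•u′|` by `biLoc_vertexOfK_slice`), then Part 27's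
`hasSum_slot_vertexOfK'` on the re-centred slice `κ′ s ↦ S₂ l t κ′ s`. -/
theorem hasSum_slot_vertex2OfK_inner (hr : r ∈ box (d + 1) Lc) (j : ℕ) (hS₂ : LocStencil₂ S₂ C₂ δ₂) (hδ₂ : 0 < δ₂)
    (μ : Fin (d + 1)) (y : Site (d + 1)) (ν : Fin (d + 1)) (x z : Site (d + 1)) (a b : Fib d) :
    HasSum (fun u' : Site (d + 1) => vertex2OfK (coDressKBmAt (toSite r) Lc (KInvStep (d := d) Lc j)) Lc S₂ μ y ν u' x z a b)
      ((stepScale d Lc j * (Lc : ℝ) ^ (d + 1))⁻¹ *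
        vertexOfK (coDressKBmAt (toSite r) Lc (KInvStep (d := d) Lc j)) Lc
          (fun l t => fun x z a b => ∑' s : Site (d + 1), (if s ν % (Lc : ℤ) = (Lc : ℤ) - 1 then S₂ l t ν s x z a b else 0)) μ y x z a b) := by
  have hLc : 1 ≤ Lc := Nat.one_le_iff_ne_zero.2 (NeZero.ne Lc)
  obtain ⟨δG, CG, hδG, hCG, hG⟩ := decays_coDressKBmAt_KInvStep (d := d) hr j
  set G := coDressKBmAt (toSite r) Lc (KInvStep (d := d) Lc j) with hGdef
  have hm : 0 < min δG δ₂ := lt_min hδG hδ₂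
  have hGm : Decays G CG (min δG δ₂) := decays_mono hG hCG le_rfl (min_le_left _ _)
  have hS₂m : LocStencil₂ S₂ C₂ (min δG δ₂) := hS₂.mono (min_le_right _ _)
  have hC₂ := hS₂.nonneg
  -- the inner rule per outer table slot `(l, t)`
  have hin : ∀ (l : Fin (d + 1)) (t : Site (d + 1)), HasSum (fun u' : Site (d + 1) => vertexOfK G Lc (S₂ l t) ν u' x z a b)
      ((stepScale d Lc j * (Lc : ℝ) ^ (d + 1))⁻¹ * ∑' s : Site (d + 1), (if s ν % (Lc : ℤ) = (Lc : ℤ) - 1 then S₂ l t ν s x z a b else 0)) :=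
    fun l t => hasSum_slot_vertexOfK' hr j (locStencil_slot₂ hS₂m hm.le l t) (half_pos hm) ν x z a b
  -- per outer direction `l`: Fubini over `(t, u′)`
  have hl : ∀ l : Fin (d + 1), HasSum (fun u' : Site (d + 1) => ∑' t : Site (d + 1), colH G Lc μ y l t * vertexOfK G Lc (S₂ l t) ν u' x z a b)
      ((stepScale d Lc j * (Lc : ℝ) ^ (d + 1))⁻¹ * ∑' t : Site (d + 1), colH G Lc μ y l t *
        ∑' s : Site (d + 1), (if s ν % (Lc : ℤ) = (Lc : ℤ) - 1 then S₂ l t ν s x z a b else 0)) := by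
    intro l
    have hFs0 : Summable (fun tu : Site (d + 1) × Site (d + 1) => vertexOfK G Lc (S₂ l tu.1) ν tu.2 x z a b * colH G Lc μ y l tu.1) := by
      refine summable_slot_table (d := d) hLc (half_pos hm) hm (c := fun u' t => vertexOfK G Lc (S₂ l t) ν u' x z a b) (T := fun t => colH G Lc μ y l t)
        (C := (d + 1 : ℕ) * (CG * C₂ * Zl (d + 1) (min δG δ₂ / 2))) (C' := CG) (fun u' t => ?_) ((Lc : ℤ) • y) (fun t => ?_)
      · have h := biLoc_vertexOfK_slice (N := Lc) hGm hCG hS₂m hm l t ν u' x z a b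
        refine h.trans ?_
        rw [← mul_assoc]
        refine mul_le_of_le_one_right (by have := Zl_nonneg (D := d + 1) (half_pos hm); positivity) (Real.exp_le_one_iff.2 ?_)
        nlinarith [l1_nonneg (x - t), l1_nonneg (z - t), hm.le]
      · have h := abs_colH_le (N := Lc) hGm μ y l t
        rwa [l1_sub_symm] at h
    have hFs : Summable (fun tu : Site (d + 1) × Site (d + 1) => colH G Lc μ y l tu.1 * vertexOfK G Lc (S₂ l tu.1) ν tu.2 x z a b) :=
      hFs0.congr fun tu => mul_comm _ _
    have hGs := (Equiv.prodComm (Site (d + 1)) (Site (d + 1))).summable_iff.2 hFs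
    have h1 := hGs.hasSum.prod_fiberwise fun u' => (hGs.prod_factor u').hasSum
    have e1 : (∑' p : Site (d + 1) × Site (d + 1), ((fun tu : Site (d + 1) × Site (d + 1) =>
        colH G Lc μ y l tu.1 * vertexOfK G Lc (S₂ l tu.1) ν tu.2 x z a b) ∘ ⇑(Equiv.prodComm (Site (d + 1)) (Site (d + 1)))) p)
        = ∑' p : Site (d + 1) × Site (d + 1), colH G Lc μ y l p.1 * vertexOfK G Lc (S₂ l p.1) ν p.2 x z a b :=
      (Equiv.prodComm (Site (d + 1)) (Site (d + 1))).tsum_eq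
        (fun tu : Site (d + 1) × Site (d + 1) => colH G Lc μ y l tu.1 * vertexOfK G Lc (S₂ l tu.1) ν tu.2 x z a b)
    rw [e1, hFs.tsum_prod] at h1
    have e3 : ∀ t : Site (d + 1), (∑' u' : Site (d + 1), colH G Lc μ y l t * vertexOfK G Lc (S₂ l t) ν u' x z a b)
        = colH G Lc μ y l t * ((stepScale d Lc j * (Lc : ℝ) ^ (d + 1))⁻¹ * ∑' s : Site (d + 1), (if s ν % (Lc : ℤ) = (Lc : ℤ) - 1 then S₂ l t ν s x z a b else 0)) := by
      intro t
      rw [tsum_mul_left, (hin l t).tsum_eq]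
    have ev : (∑' t : Site (d + 1), colH G Lc μ y l t * ((stepScale d Lc j * (Lc : ℝ) ^ (d + 1))⁻¹ *
          ∑' s : Site (d + 1), (if s ν % (Lc : ℤ) = (Lc : ℤ) - 1 then S₂ l t ν s x z a b else 0)))
        = (stepScale d Lc j * (Lc : ℝ) ^ (d + 1))⁻¹ * ∑' t : Site (d + 1), colH G Lc μ y l t *
          ∑' s : Site (d + 1), (if s ν % (Lc : ℤ) = (Lc : ℤ) - 1 then S₂ l t ν s x z a b else 0) := by
      rw [← tsum_mul_left]
      exact tsum_congr fun t => by ring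
    simp only [Function.comp, Equiv.prodComm_apply, Prod.swap, e3, ev] at h1
    exact h1
  have h := hasSum_sum fun l (_ : l ∈ (Finset.univ : Finset (Fin (d + 1)))) => hl l
  rw [← Finset.mul_sum] at h
  have ef : (fun u' : Site (d + 1) => vertex2OfK G Lc S₂ μ y ν u' x z a b)
      = fun u' => ∑ l : Fin (d + 1), ∑' t : Site (d + 1), colH G Lc μ y l t * vertexOfK G Lc (S₂ l t) ν u' x z a b := by
    funext u'
    simp only [vertex2OfK, vertexOfK, wsum]
  have ev : vertexOfK G Lc (fun l t => fun x z a b => ∑' s : Site (d + 1), (if s ν % (Lc : ℤ) = (Lc : ℤ) - 1 then S₂ l t ν s x z a b else 0)) μ y x z a b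
      = ∑ l : Fin (d + 1), ∑' t : Site (d + 1), colH G Lc μ y l t * ∑' s : Site (d + 1), (if s ν % (Lc : ℤ) = (Lc : ℤ) - 1 then S₂ l t ν s x z a b else 0) := by
    simp only [vertexOfK, wsum]
  rw [ef, ev]
  exact h

/-- NOT IN PRINT; OUR BOOKKEEPING.  **THE OUTER SLOT ZERO MODE OF THE BI-VERTEX** (every `j`, in-block root, ANY `LocStencil₂ S₂` at a positive rate, entrywise):
`Σ_{u′} (vertex2OfK G_j Lc S₂ ν u′ μ y) x z a b = cH_j·Σ'_t 𝟙[t_ν % Lc = Lc−1]·(vertexOfK G_j Lc (S₂ ν t) μ y) x z a b` — Part 27's `hasSum_slot_vertexOfK'` VERBATIM on the local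
stencil family `l t ↦ vertexOfK G_j Lc (S₂ l t) μ y` (self-localised at `t` by an2's `biLoc_vertexOfK_slice`, constants bounded uniformly). -/
theorem hasSum_slot_vertex2OfK_outer (hr : r ∈ box (d + 1) Lc) (j : ℕ) (hS₂ : LocStencil₂ S₂ C₂ δ₂) (hδ₂ : 0 < δ₂)
    (ν : Fin (d + 1)) (μ : Fin (d + 1)) (y : Site (d + 1)) (x z : Site (d + 1)) (a b : Fib d) :
    HasSum (fun u' : Site (d + 1) => vertex2OfK (coDressKBmAt (toSite r) Lc (KInvStep (d := d) Lc j)) Lc S₂ ν u' μ y x z a b)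
      ((stepScale d Lc j * (Lc : ℝ) ^ (d + 1))⁻¹ *
        ∑' t : Site (d + 1), (if t ν % (Lc : ℤ) = (Lc : ℤ) - 1 then
          vertexOfK (coDressKBmAt (toSite r) Lc (KInvStep (d := d) Lc j)) Lc (S₂ ν t) μ y x z a b else 0)) := by
  obtain ⟨δG, CG, hδG, hCG, hG⟩ := decays_coDressKBmAt_KInvStep (d := d) hr j
  have hm : 0 < min δG δ₂ := lt_min hδG hδ₂
  have hGm : Decays (coDressKBmAt (toSite r) Lc (KInvStep (d := d) Lc j)) CG (min δG δ₂) := decays_mono hG hCG le_rfl (min_le_left _ _)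
  have hS₂m : LocStencil₂ S₂ C₂ (min δG δ₂) := hS₂.mono (min_le_right _ _)
  have hC₂ := hS₂.nonneg
  have hZ := Zl_nonneg (D := d + 1) (half_pos hm)
  -- the inner vertices form a local stencil family in the outer table slot
  have hF : LocStencil (fun l t => vertexOfK (coDressKBmAt (toSite r) Lc (KInvStep (d := d) Lc j)) Lc (S₂ l t) μ y)
      ((d + 1 : ℕ) * (CG * C₂ * Zl (d + 1) (min δG δ₂ / 2))) (min δG δ₂) := by
    intro l t x z a b
    have h := biLoc_vertexOfK_slice (N := Lc) hGm hCG hS₂m hm l t μ y x z a b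
    refine h.trans (mul_le_mul_of_nonneg_right ?_ (Real.exp_pos _).le)
    exact mul_le_mul_of_nonneg_left (mul_le_of_le_one_right (by positivity) (Real.exp_le_one_iff.2 (by nlinarith [l1_nonneg (t - (Lc : ℤ) • y), hm.le])))
      (by positivity)
  exact hasSum_slot_vertexOfK' hr j hF hm ν x z a b

/-! ## §3 The same under the face-weighted pair sum of the legs -/

/-- NOT IN PRINT; OUR BOOKKEEPING.  **THE INNER SLOT ZERO MODE OF THE FACE-WEIGHTED BI-VERTEX WORD** (`|ρ₁|, |ρ₂| ≤ 1`, fibre legs `a b`):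
`HasSum (u′ ↦ Σ'_{(x,z)} ρ₁(x)ρ₂(z)·(vertex2OfK G_j Lc S₂ μ y ν u′) x z a b) (cH_j·Σ'_{(x,z)} ρ₁(x)ρ₂(z)·(vertexOfK G_j Lc (l t ↦ Σ'_s 𝟙[s_ν % Lc = Lc−1]·S₂ l t ν s) μ y) x z a b)` —
the `(u′, (x, z))` family converges absolutely (`biLoc_vertex2OfK_far` + leaf-04's `summable_prod_of_centreTied`), so the slot sum moves inside the pair sum, where §2 applies. -/
theorem hasSum_slot_twoFace_vertex2OfK_inner (hr : r ∈ box (d + 1) Lc) (j : ℕ) (hS₂ : LocStencil₂ S₂ C₂ δ₂) (hδ₂ : 0 < δ₂)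
    {ρ₁ ρ₂ : Site (d + 1) → ℝ} (h₁ : ∀ x, |ρ₁ x| ≤ 1) (h₂ : ∀ z, |ρ₂ z| ≤ 1) (μ : Fin (d + 1)) (y : Site (d + 1)) (ν : Fin (d + 1)) (a b : Fib d) :
    HasSum (fun u' : Site (d + 1) => ∑' xz : Site (d + 1) × Site (d + 1),
        ρ₁ xz.1 * ρ₂ xz.2 * vertex2OfK (coDressKBmAt (toSite r) Lc (KInvStep (d := d) Lc j)) Lc S₂ μ y ν u' xz.1 xz.2 a b)
      ((stepScale d Lc j * (Lc : ℝ) ^ (d + 1))⁻¹ * ∑' xz : Site (d + 1) × Site (d + 1), ρ₁ xz.1 * ρ₂ xz.2 *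
        vertexOfK (coDressKBmAt (toSite r) Lc (KInvStep (d := d) Lc j)) Lc
          (fun l t => fun x z a b => ∑' s : Site (d + 1), (if s ν % (Lc : ℤ) = (Lc : ℤ) - 1 then S₂ l t ν s x z a b else 0)) μ y xz.1 xz.2 a b) := by
  obtain ⟨δG, CG, hδG, hCG, hG⟩ := decays_coDressKBmAt_KInvStep (d := d) hr j
  set G := coDressKBmAt (toSite r) Lc (KInvStep (d := d) Lc j) with hGdef
  have hm : 0 < min δG δ₂ := lt_min hδG hδ₂
  have hGm : Decays G CG (min δG δ₂) := decays_mono hG hCG le_rfl (min_le_left _ _)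
  have hS₂m : LocStencil₂ S₂ C₂ (min δG δ₂) := hS₂.mono (min_le_right _ _)
  -- the weighted family is centre-tied at `Lc•y`
  have hfar : ∀ u' : Site (d + 1), BiLoc (fun x z a b => ρ₁ x * ρ₂ z * vertex2OfK G Lc S₂ μ y ν u' x z a b) ((Lc : ℤ) • y) ((Lc : ℤ) • y)
      ((((d + 1 : ℕ) : ℝ) * (CG * ((d + 1 : ℕ) * (CG * C₂ * Zl (d + 1) (min δG δ₂ / 2))) * Zl (d + 1) (min δG δ₂ / 8))) *
        Real.exp (-(min δG δ₂ / 8) * l1 ((Lc : ℤ) • u' - (Lc : ℤ) • y))) (min δG δ₂ / 8) := by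
    intro u'
    have h := biLoc_vertex2OfK_far (N := Lc) hGm hCG hS₂m hm μ y ν u'
    rw [l1_sub_symm ((Lc : ℤ) • y) ((Lc : ℤ) • u')] at h
    exact biLoc_twoFace_weight h h₁ h₂
  have hGs := summable_prod_of_centreTied (N := Lc) (V := fun u' => fun x z a b => ρ₁ x * ρ₂ z * vertex2OfK G Lc S₂ μ y ν u' x z a b)
    (show (0 : ℝ) < min δG δ₂ / 8 by positivity) hfar a b
  -- `hGs : Summable fun q : u′ × (x, z) ↦ ρ₁ x·ρ₂ z·vertex2OfK … u′ x z a b`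
  have h1 := hGs.hasSum.prod_fiberwise fun u' => (hGs.prod_factor u').hasSum
  -- the value: swap to `((x,z), u′)` and sum the `u′`-fibres by §2
  have hg : Summable (fun c : (Site (d + 1) × Site (d + 1)) × Site (d + 1) => ρ₁ c.1.1 * ρ₂ c.1.2 * vertex2OfK G Lc S₂ μ y ν c.2 c.1.1 c.1.2 a b) :=
    ((Equiv.prodComm (Site (d + 1)) (Site (d + 1) × Site (d + 1))).summable_iff
      (f := fun c : (Site (d + 1) × Site (d + 1)) × Site (d + 1) => ρ₁ c.1.1 * ρ₂ c.1.2 * vertex2OfK G Lc S₂ μ y ν c.2 c.1.1 c.1.2 a b)).1 hGs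
  have e1 : (∑' q : Site (d + 1) × (Site (d + 1) × Site (d + 1)), ρ₁ q.2.1 * ρ₂ q.2.2 * vertex2OfK G Lc S₂ μ y ν q.1 q.2.1 q.2.2 a b)
      = ∑' c : (Site (d + 1) × Site (d + 1)) × Site (d + 1), ρ₁ c.1.1 * ρ₂ c.1.2 * vertex2OfK G Lc S₂ μ y ν c.2 c.1.1 c.1.2 a b := by
    rw [← (Equiv.prodComm (Site (d + 1)) (Site (d + 1) × Site (d + 1))).tsum_eq
      (fun c : (Site (d + 1) × Site (d + 1)) × Site (d + 1) => ρ₁ c.1.1 * ρ₂ c.1.2 * vertex2OfK G Lc S₂ μ y ν c.2 c.1.1 c.1.2 a b)]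
    exact tsum_congr fun q => by simp only [Equiv.prodComm_apply, Prod.fst_swap, Prod.snd_swap]
  have e2 : ∀ xz : Site (d + 1) × Site (d + 1), (∑' u' : Site (d + 1), ρ₁ xz.1 * ρ₂ xz.2 * vertex2OfK G Lc S₂ μ y ν u' xz.1 xz.2 a b)
      = ρ₁ xz.1 * ρ₂ xz.2 * ((stepScale d Lc j * (Lc : ℝ) ^ (d + 1))⁻¹ * vertexOfK G Lc
          (fun l t => fun x z a b => ∑' s : Site (d + 1), (if s ν % (Lc : ℤ) = (Lc : ℤ) - 1 then S₂ l t ν s x z a b else 0)) μ y xz.1 xz.2 a b) := by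
    intro xz
    rw [tsum_mul_left, (hasSum_slot_vertex2OfK_inner hr j hS₂ hδ₂ μ y ν xz.1 xz.2 a b).tsum_eq]
  rw [e1, hg.tsum_prod] at h1
  simp only [e2] at h1
  have ev : (∑' xz : Site (d + 1) × Site (d + 1), ρ₁ xz.1 * ρ₂ xz.2 * ((stepScale d Lc j * (Lc : ℝ) ^ (d + 1))⁻¹ * vertexOfK G Lc
          (fun l t => fun x z a b => ∑' s : Site (d + 1), (if s ν % (Lc : ℤ) = (Lc : ℤ) - 1 then S₂ l t ν s x z a b else 0)) μ y xz.1 xz.2 a b))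
      = (stepScale d Lc j * (Lc : ℝ) ^ (d + 1))⁻¹ * ∑' xz : Site (d + 1) × Site (d + 1), ρ₁ xz.1 * ρ₂ xz.2 * vertexOfK G Lc
          (fun l t => fun x z a b => ∑' s : Site (d + 1), (if s ν % (Lc : ℤ) = (Lc : ℤ) - 1 then S₂ l t ν s x z a b else 0)) μ y xz.1 xz.2 a b := by
    rw [← tsum_mul_left]
    exact tsum_congr fun xz => by ring
  rw [ev] at h1
  exact h1

/-- NOT IN PRINT; OUR BOOKKEEPING.  **THE OUTER SLOT ZERO MODE OF THE FACE-WEIGHTED BI-VERTEX WORD**: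
`HasSum (u′ ↦ Σ'_{(x,z)} ρ₁(x)ρ₂(z)·(vertex2OfK G_j Lc S₂ ν u′ μ y) x z a b) (cH_j·Σ'_{(x,z)} ρ₁(x)ρ₂(z)·Σ'_t 𝟙[t_ν % Lc = Lc−1]·(vertexOfK G_j Lc (S₂ ν t) μ y) x z a b)` — the family is
bi-localised at the MOVING centre `Lc•u′` with constants decaying from `Lc•y` (`biLoc_vertex2OfK_far` read with the bonds exchanged), so `summable_prod_of_movingCentre` licenses the
exchange and §2's outer rule applies inside. -/
theorem hasSum_slot_twoFace_vertex2OfK_outer (hr : r ∈ box (d + 1) Lc) (j : ℕ) (hS₂ : LocStencil₂ S₂ C₂ δ₂) (hδ₂ : 0 < δ₂)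
    {ρ₁ ρ₂ : Site (d + 1) → ℝ} (h₁ : ∀ x, |ρ₁ x| ≤ 1) (h₂ : ∀ z, |ρ₂ z| ≤ 1) (ν : Fin (d + 1)) (μ : Fin (d + 1)) (y : Site (d + 1)) (a b : Fib d) :
    HasSum (fun u' : Site (d + 1) => ∑' xz : Site (d + 1) × Site (d + 1),
        ρ₁ xz.1 * ρ₂ xz.2 * vertex2OfK (coDressKBmAt (toSite r) Lc (KInvStep (d := d) Lc j)) Lc S₂ ν u' μ y xz.1 xz.2 a b)
      ((stepScale d Lc j * (Lc : ℝ) ^ (d + 1))⁻¹ * ∑' xz : Site (d + 1) × Site (d + 1), ρ₁ xz.1 * ρ₂ xz.2 *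
        ∑' t : Site (d + 1), (if t ν % (Lc : ℤ) = (Lc : ℤ) - 1 then
          vertexOfK (coDressKBmAt (toSite r) Lc (KInvStep (d := d) Lc j)) Lc (S₂ ν t) μ y xz.1 xz.2 a b else 0)) := by
  obtain ⟨δG, CG, hδG, hCG, hG⟩ := decays_coDressKBmAt_KInvStep (d := d) hr j
  set G := coDressKBmAt (toSite r) Lc (KInvStep (d := d) Lc j) with hGdef
  have hm : 0 < min δG δ₂ := lt_min hδG hδ₂
  have hGm : Decays G CG (min δG δ₂) := decays_mono hG hCG le_rfl (min_le_left _ _)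
  have hS₂m : LocStencil₂ S₂ C₂ (min δG δ₂) := hS₂.mono (min_le_right _ _)
  -- the weighted family is bi-localised at the moving centre `Lc•u′`, constants decaying from `Lc•y`
  have hmov : ∀ u' : Site (d + 1), BiLoc (fun x z a b => ρ₁ x * ρ₂ z * vertex2OfK G Lc S₂ ν u' μ y x z a b) ((Lc : ℤ) • u') ((Lc : ℤ) • u')
      ((((d + 1 : ℕ) : ℝ) * (CG * ((d + 1 : ℕ) * (CG * C₂ * Zl (d + 1) (min δG δ₂ / 2))) * Zl (d + 1) (min δG δ₂ / 8))) *
        Real.exp (-(min δG δ₂ / 8) * l1 ((Lc : ℤ) • u' - (Lc : ℤ) • y))) (min δG δ₂ / 8) :=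
    fun u' => biLoc_twoFace_weight (biLoc_vertex2OfK_far (N := Lc) hGm hCG hS₂m hm ν u' μ y) h₁ h₂
  have hGs := summable_prod_of_movingCentre (N := Lc) (V := fun u' => fun x z a b => ρ₁ x * ρ₂ z * vertex2OfK G Lc S₂ ν u' μ y x z a b)
    (show (0 : ℝ) < min δG δ₂ / 8 by positivity) hmov a b
  have h1 := hGs.hasSum.prod_fiberwise fun u' => (hGs.prod_factor u').hasSum
  have hg : Summable (fun c : (Site (d + 1) × Site (d + 1)) × Site (d + 1) => ρ₁ c.1.1 * ρ₂ c.1.2 * vertex2OfK G Lc S₂ ν c.2 μ y c.1.1 c.1.2 a b) :=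
    ((Equiv.prodComm (Site (d + 1)) (Site (d + 1) × Site (d + 1))).summable_iff
      (f := fun c : (Site (d + 1) × Site (d + 1)) × Site (d + 1) => ρ₁ c.1.1 * ρ₂ c.1.2 * vertex2OfK G Lc S₂ ν c.2 μ y c.1.1 c.1.2 a b)).1 hGs
  have e1 : (∑' q : Site (d + 1) × (Site (d + 1) × Site (d + 1)), ρ₁ q.2.1 * ρ₂ q.2.2 * vertex2OfK G Lc S₂ ν q.1 μ y q.2.1 q.2.2 a b)
      = ∑' c : (Site (d + 1) × Site (d + 1)) × Site (d + 1), ρ₁ c.1.1 * ρ₂ c.1.2 * vertex2OfK G Lc S₂ ν c.2 μ y c.1.1 c.1.2 a b := by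
    rw [← (Equiv.prodComm (Site (d + 1)) (Site (d + 1) × Site (d + 1))).tsum_eq
      (fun c : (Site (d + 1) × Site (d + 1)) × Site (d + 1) => ρ₁ c.1.1 * ρ₂ c.1.2 * vertex2OfK G Lc S₂ ν c.2 μ y c.1.1 c.1.2 a b)]
    exact tsum_congr fun q => by simp only [Equiv.prodComm_apply, Prod.fst_swap, Prod.snd_swap]
  have e2 : ∀ xz : Site (d + 1) × Site (d + 1), (∑' u' : Site (d + 1), ρ₁ xz.1 * ρ₂ xz.2 * vertex2OfK G Lc S₂ ν u' μ y xz.1 xz.2 a b)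
      = ρ₁ xz.1 * ρ₂ xz.2 * ((stepScale d Lc j * (Lc : ℝ) ^ (d + 1))⁻¹ *
          ∑' t : Site (d + 1), (if t ν % (Lc : ℤ) = (Lc : ℤ) - 1 then vertexOfK G Lc (S₂ ν t) μ y xz.1 xz.2 a b else 0)) := by
    intro xz
    rw [tsum_mul_left, (hasSum_slot_vertex2OfK_outer hr j hS₂ hδ₂ ν μ y xz.1 xz.2 a b).tsum_eq]
  rw [e1, hg.tsum_prod] at h1
  simp only [e2] at h1
  have ev : (∑' xz : Site (d + 1) × Site (d + 1), ρ₁ xz.1 * ρ₂ xz.2 * ((stepScale d Lc j * (Lc : ℝ) ^ (d + 1))⁻¹ *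
          ∑' t : Site (d + 1), (if t ν % (Lc : ℤ) = (Lc : ℤ) - 1 then vertexOfK G Lc (S₂ ν t) μ y xz.1 xz.2 a b else 0)))
      = (stepScale d Lc j * (Lc : ℝ) ^ (d + 1))⁻¹ * ∑' xz : Site (d + 1) × Site (d + 1), ρ₁ xz.1 * ρ₂ xz.2 *
          ∑' t : Site (d + 1), (if t ν % (Lc : ℤ) = (Lc : ℤ) - 1 then vertexOfK G Lc (S₂ ν t) μ y xz.1 xz.2 a b else 0) := by
    rw [← tsum_mul_left]
    exact tsum_congr fun xz => by ring
  rw [ev] at h1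
  exact h1

end Wall

end Summit.QuantumFields.BalabanUV.Beta.GAN24.BiVertexSlotZeroMode

end
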